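import Literature.Geometry.Lorentzian.CausalCurveNullGeodesic
import Literature.Geometry.Lorentzian.AchronalHypersurfaceCausal
import Literature.Geometry.Lorentzian.EventHorizonAreaProofs
import Literature.Geometry.Lorentzian.GeodesicExtension
import HarnessLib

/-!
# Causal curves between points of a horizon run along generators
(Chruściel–Delay–Galloway–Howard 2001, §2 and §6 — the causal front end of the area theorem)

Let `𝓗` be a horizon in the sense of Chruściel–Delay–Galloway–Howard 2001, §2 — in the tree's
vocabulary for the area theorem `ChruscielEtAl2001_areaTheorem`: a closed, achronal, embedded
topological hypersurface of a `4`-dimensional spacetime, ruled by future-complete null geodesics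
(`Spacetime.IsRuledByCompleteNullGeodesics`). **Theorem**
(`Spacetime.exists_generator_of_isFutureCausalCurveOn`): if `γ : [a, b] → M` (`a < b`) is a
future causal curve with `γ a, γ b ∈ 𝓗`, then the maximal null geodesic `γ_ℓ` from `γ a` in a
suitable future null direction `ℓ` is a **complete generator of `𝓗` through `γ a` and `γ b`**:
`[0, ∞) ⊆ dom γ_ℓ`, `γ_ℓ([0, ∞)) ⊆ 𝓗`, `γ_ℓ'` is future null there, and `γ = γ_ℓ ∘ φ` on `[a, b]`
for a continuous strictly increasing `φ` with `φ a = 0`. This is what the proof of CDGH's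
Thm. 6.1 (p. 22: "every `q ∈ A` is on exactly one of the generators …", "there is a bijective
correspondence between `φ⁻¹[p]` and the null generators of `𝓗` passing through `p`",
`N(p, S₂) ≥ 1` for `S₁ ⊆ J⁻(S₂)`) extracts from causality theory.

Proof: `γ = γ_ℓ ∘ φ` is a reparametrised null geodesic (`IsAchronal.exists_null_maximalGeodesic`,
O'Neill Prop. 10.46 for differentiable curves), it lies in `𝓗`
(`Spacetime.mapsTo_of_isFutureCausalCurveOn_of_isAchronal`), so `γ_ℓ([0, φ b]) ⊆ 𝓗`; at
`q = γ b` the generator `ρ` of the ruling through `q` leaves `q` without corner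
(`IsAchronal.exists_pos_smul_velocity_eq`: otherwise a chronology violation inside the achronal
`𝓗`), hence `ρ` is the continuation of `γ_ℓ` (a geodesic ray is an initial segment of the maximal
geodesic through its tangent lift, `IsGeodesicOn.Ici_subset_maximalGeodesicDomain`, and the flow
property of maximal geodesics), which is therefore complete to the future and stays in `𝓗`.

Everything is proved; no definitions and no named facts are introduced (D-0026). Layer L0 of the
programme for `ChruscielEtAl2001_areaTheorem`.

## References

* P. T. Chruściel, E. Delay, G. J. Galloway, R. Howard, *Regularity of horizons and the area
  theorem*, Ann. Henri Poincaré 2 (2001) 109–178, §2, §6 (proof of Thm. 6.1). [ChruscielEtAl2001]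
* B. O'Neill, *Semi-Riemannian geometry with applications to relativity*, Academic Press 1983,
  Ch. 3, Lemma 22–23 (uniqueness, maximal geodesics); Ch. 10, Prop. 10.46; Ch. 14, p. 413.
  [ONeillSemiRiemannian1983]
-/

noncomputable section

universe u

open Bundle Set Filter Function
open scoped Manifold ContDiff Topology

namespace Literature.Geometry.Lorentzian

open Literature.Geometry.Riemannian

/-! ### A geodesic ray is an initial segment of the maximal geodesic through its tangent lift -/

section Ray

variable {E : Type*} [NormedAddCommGroup E] [NormedSpace ℝ E] {H : Type*} [TopologicalSpace H]
  {I : ModelWithCorners ℝ E H} {M : Type*} [TopologicalSpace M] [ChartedSpace H M]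
  [IsManifold I ∞ M] [FiniteDimensional ℝ E] [CompleteSpace E] [T2Space M]
  [BoundarylessManifold I M] {cov : CovariantDerivative I E (TangentSpace I : M → Type _)}
  [CovariantDerivative.ContMDiffCovariantDerivative cov 1]

/-- **A geodesic ray lies on the maximal geodesic through its initial tangent lift** (O'Neill
1983, Ch. 3, Lemma 22 and p. 68: uniqueness and the maximal geodesic). If `ρ` is a geodesic on
`[t₀, ∞)` then for every `s ≥ 0`, `s ∈ dom γ_{ρ'(t₀)}` and `γ_{ρ'(t₀)}(s) = ρ(t₀ + s)`: the
translate `s ↦ ρ(t₀ + s)` agrees with the maximal geodesic `γ_{ρ'(t₀)}` on a small `[0, d]`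
(one-sided uniqueness, `IsGeodesicOn.eqOn_Icc_of_velocity_eq`), so the two glue
(`IsGeodesicOn.piecewise`) to a geodesic on `dom γ_{ρ'(t₀)} ∪ (0, ∞)` with the same initial data,
which by maximality is defined on no more than `dom γ_{ρ'(t₀)}`.
[cite: ONeillSemiRiemannian1983, Ch. 3, Lemma 22 and p. 68] -/
theorem IsGeodesicOn.mem_maximalGeodesicDomain_of_ray {ρ : ℝ → M} {t₀ : ℝ}
    (hρ : IsGeodesicOn cov ρ (Ici t₀)) {s : ℝ} (hs : 0 ≤ s) :
    s ∈ maximalGeodesicDomain cov (ρ t₀) (velocity I ρ t₀) ∧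
      maximalGeodesic cov (ρ t₀) (velocity I ρ t₀) s = ρ (t₀ + s) := by
  classical
  obtain ⟨hνmax, hν0, hνx, hνv⟩ := maximalGeodesic_spec' (cov := cov) (ρ t₀) (velocity I ρ t₀)
  set ν := maximalGeodesic cov (ρ t₀) (velocity I ρ t₀) with hν
  set D := maximalGeodesicDomain cov (ρ t₀) (velocity I ρ t₀) with hD
  have hDo : IsOpen D := hνmax.isOpen
  -- the translate `β u = ρ (u + t₀)`, a geodesic on `[0, ∞)`
  set β : ℝ → M := fun u ↦ ρ (u - -t₀) with hβ
  have hβgeo : IsGeodesicOn cov β (Ici 0) := by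
    have h := hρ.comp_sub_const (-t₀)
    refine h.mono fun u hu ↦ ?_
    show u - -t₀ ∈ Ici t₀
    simp only [mem_Ici, sub_neg_eq_add] at hu ⊢
    linarith
  have hβ0 : β 0 = ρ t₀ := by show ρ (0 - -t₀) = ρ t₀; rw [zero_sub, neg_neg]
  have hβv : velocity I β 0 = velocity I ρ t₀ := by
    rw [hβ, velocity_comp_sub_const ρ (-t₀) 0, zero_sub, neg_neg]
  have hβval : ∀ u, β u = ρ (t₀ + u) := fun u ↦ by
    show ρ (u - -t₀) = ρ (t₀ + u); congr 1; ring
  -- a small `[0, d] ⊆ D`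
  obtain ⟨ε, hε, hball⟩ := Metric.isOpen_iff.1 hDo 0 hν0
  set d : ℝ := ε / 2 with hd
  have hdpos : 0 < d := by rw [hd]; linarith
  have hIcc : Icc 0 d ⊆ D := fun u hu ↦ hball (by
    rw [Metric.mem_ball, Real.dist_eq, sub_zero, abs_lt]
    constructor <;> linarith [hu.1, hu.2])
  -- one-sided uniqueness on `[0, d]`
  have heq : EqOn ν β (Icc 0 d) :=
    (hνmax.isGeodesicOn.mono hIcc).eqOn_Icc_of_velocity_eq (hβgeo.mono Icc_subset_Ici_self)
      (hνx.trans hβ0.symm) (hνv.trans hβv.symm)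
  -- gluing on `D ∪ (0, ∞)`
  have ht₁ : d / 2 ∈ D ∩ Ioi 0 := ⟨hIcc ⟨by linarith, by linarith⟩, by show 0 < d / 2; linarith⟩
  have hlift : tangentLift I ν (d / 2) = tangentLift I β (d / 2) := by
    refine tangentLift_congr_of_eventuallyEq (I := I) ?_
    have hnhds : Ioo 0 d ∈ 𝓝 (d / 2) := isOpen_Ioo.mem_nhds ⟨by linarith, by linarith⟩
    filter_upwards [hnhds] with u hu
    exact heq ⟨hu.1.le, hu.2.le⟩
  have hUV : (D ∩ Ioi 0).OrdConnected := hνmax.2.1.inter ordConnected_Ioi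
  obtain ⟨hG, hGν, hGβ⟩ := hνmax.isGeodesicOn.piecewise hDo isOpen_Ioi hUV
    (hβgeo.mono Ioi_subset_Ici_self) ht₁ hlift
  set G := D.piecewise ν β with hGdef
  -- maximality: `D ∪ (0, ∞) ⊆ D`
  have hUo : IsOpen (D ∪ Ioi 0) := hDo.union isOpen_Ioi
  have hUc : (D ∪ Ioi 0).OrdConnected := by
    refine ⟨fun x hx y hy z hz ↦ ?_⟩
    rcases lt_or_ge 0 z with h0z | hz0
    · exact Or.inr h0z
    · -- `z ≤ 0`: then `x ≤ z ≤ 0`, so `x ∈ D`, and `z ∈ [x, 0] ⊆ D`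
      have hxD : x ∈ D := by
        rcases hx with hx | hx
        · exact hx
        · exact (lt_irrefl _ (lt_of_lt_of_le (lt_of_lt_of_le hx hz.1) hz0)).elim
      exact Or.inl (hνmax.2.1.out hxD hν0 ⟨hz.1, hz0⟩)
  have h0U : (0 : ℝ) ∈ D ∪ Ioi 0 := Or.inl hν0
  have hG0 : G 0 = ρ t₀ := (hGν hν0).trans hνx
  have hGv : velocity I G 0 = velocity I ρ t₀ := by
    have hev : G =ᶠ[𝓝 0] ν := by
      filter_upwards [hDo.mem_nhds hν0] with u hu using hGν hu
    rw [velocity_congr_of_eventuallyEq (I := I) hev, hνv]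
  obtain ⟨hsub, hGeq⟩ := subset_maximalGeodesicDomain_of_isGeodesicOn hUo hUc h0U hG hG0 hGv
  rcases eq_or_lt_of_le hs with h | hspos
  · subst h
    refine ⟨hν0, ?_⟩
    rw [add_zero]; exact hνx
  · have hsU : s ∈ D ∪ Ioi 0 := Or.inr hspos
    refine ⟨hsub hsU, ?_⟩
    have h1 : G s = ν s := hGeq hsU
    rw [← h1, hGβ hspos, hβval]

end Ray

/-! ### Generators of a horizon through the endpoints of a causal curve -/

namespace Spacetime

variable (𝓢 : Spacetime.{u} 4) [𝓢.metric.HasLeviCivita]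

/-- **Causal curves between points of a horizon run along complete generators**
(Chruściel–Delay–Galloway–Howard 2001, §2 and §6, proof of Thm. 6.1). Let `𝓗` be a closed,
achronal, embedded topological hypersurface of a `4`-dimensional spacetime, ruled by
future-complete null geodesics, and `γ` a future causal curve on `[a, b]` (`a < b`) with
`γ a, γ b ∈ 𝓗`. Then there are a future null `ℓ ∈ T_{γ a}M` and a continuous strictly increasing
`φ : [a, b] → ℝ`, `φ a = 0`, such that the maximal geodesic `γ_ℓ` satisfies `[0, ∞) ⊆ dom γ_ℓ`,
`γ_ℓ([0, ∞)) ⊆ 𝓗`, `γ_ℓ'(s)` is future null for `s ≥ 0` — a complete generator of `𝓗` — and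
`γ t = γ_ℓ(φ t)` for `t ∈ [a, b]`. See the module docstring for the proof.
[cite: ChruscielEtAl2001, §6, proof of Thm. 6.1 (p. 22)] -/
theorem exists_generator_of_isFutureCausalCurveOn {𝓗 : Set 𝓢.carrier} (hcl : IsClosed 𝓗)
    (h𝓗 : 𝓢.metric.IsAchronal 𝓢.timeOrientation 𝓗) (htop : IsTopologicalSubmanifold 3 𝓗)
    (hrule : 𝓢.IsRuledByCompleteNullGeodesics 𝓗) {γ : ℝ → 𝓢.carrier} {a b : ℝ} (hab : a < b)
    (hγ : 𝓢.metric.IsFutureCausalCurveOn 𝓢.timeOrientation γ (Icc a b))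
    (ha : γ a ∈ 𝓗) (hb : γ b ∈ 𝓗) :
    ∃ (ℓ : TangentSpace (𝓡 4) (γ a)) (φ : ℝ → ℝ),
      𝓢.metric.IsNull ℓ ∧ 𝓢.timeOrientation.IsFutureDirected ℓ ∧
      Ici (0 : ℝ) ⊆ maximalGeodesicDomain 𝓢.metric.leviCivita (γ a) ℓ ∧
      MapsTo (maximalGeodesic 𝓢.metric.leviCivita (γ a) ℓ) (Ici 0) 𝓗 ∧
      (∀ s ∈ Ici (0 : ℝ),
        𝓢.metric.IsNull (velocity (𝓡 4) (maximalGeodesic 𝓢.metric.leviCivita (γ a) ℓ) s) ∧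
        𝓢.timeOrientation.IsFutureDirected
          (velocity (𝓡 4) (maximalGeodesic 𝓢.metric.leviCivita (γ a) ℓ) s)) ∧
      φ a = 0 ∧ ContinuousOn φ (Icc a b) ∧ StrictMonoOn φ (Icc a b) ∧
      (∀ t ∈ Icc a b, φ t ∈ maximalGeodesicDomain 𝓢.metric.leviCivita (γ a) ℓ ∧
        γ t = maximalGeodesic 𝓢.metric.leviCivita (γ a) ℓ (φ t)) := by
  haveI : CovariantDerivative.ContMDiffCovariantDerivative 𝓢.metric.leviCivita 1 :=
    contMDiffCovariantDerivative_leviCivita_one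
  set g := 𝓢.metric with hg
  set τ := 𝓢.timeOrientation with hτ
  set cov := 𝓢.metric.leviCivita with hcov
  have hn1 : (1 : ℕ∞ω) ≤ ∞ := by exact_mod_cast le_top
  -- (1) `γ` is a reparametrised null geodesic `μ ∘ φ`
  obtain ⟨ℓ, φ, hℓn, hℓf, hφa, hφc, hφm, hφμ, hφvel⟩ :=
    LorentzianMetric.IsAchronal.exists_null_maximalGeodesic τ le_rfl h𝓗 hab hγ ha hb
  obtain ⟨hμmax, hμ0, hμx, hμv⟩ := maximalGeodesic_spec' (cov := cov) (γ a) ℓ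
  set μ := maximalGeodesic cov (γ a) ℓ with hμ
  set D := maximalGeodesicDomain cov (γ a) ℓ with hD
  set S : ℝ := φ b with hS
  have hbmem : b ∈ Icc a b := ⟨hab.le, le_rfl⟩
  have hamem : a ∈ Icc a b := ⟨le_rfl, hab.le⟩
  have hSpos : 0 < S := by rw [hS, ← hφa]; exact hφm hamem hbmem hab
  have hSD : S ∈ D := (hφμ b hbmem).1
  have hμS : μ S = γ b := (hφμ b hbmem).2.symm
  -- future null velocity along `μ` on `D`
  have hμnf : ∀ s ∈ D, g.IsNull (velocity (𝓡 4) μ s) ∧ τ.IsFutureDirected (velocity (𝓡 4) μ s) :=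
    fun s hs ↦ hμmax.isGeodesicOn.isNull_and_isFutureDirected_velocity g τ hμmax.isOpen hμmax.2.1
      hμ0 (by rw [hμv, hμx]; exact hℓn) (by rw [hμv, hμx]; exact hℓf) hs
  -- (2) `γ`, hence `μ([0, S])`, lies in `𝓗`
  have hγ𝓗 : MapsTo γ (Icc a b) 𝓗 :=
    𝓢.mapsTo_of_isFutureCausalCurveOn_of_isAchronal hcl h𝓗 htop hγ ha hb
  have h0S : Icc 0 S ⊆ D := hμmax.2.1.out hμ0 hSD
  have hμ𝓗₁ : ∀ s ∈ Icc 0 S, μ s ∈ 𝓗 := by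
    intro s hs
    have hivt := intermediate_value_Icc hab.le hφc
    rw [hφa] at hivt
    obtain ⟨t, ht, hts⟩ := hivt hs
    rw [← hts, ← (hφμ t ht).2]
    exact hγ𝓗 ht
  -- (3) the generator of the ruling through `q = γ b`, and no corner at `q`
  obtain ⟨ρ, a', t₀', ha't₀', hρq, hρgeo, hρnf, hρ𝓗⟩ := hrule (γ b) hb
  have h₁ : g.IsFutureCausalCurveOn τ μ (Icc 0 S) := fun s hs ↦
    ⟨IsGeodesicOn.mdifferentiableAt_holds hμmax.isGeodesicOn (h0S hs), (hμnf s (h0S hs)).2⟩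
  have h₂ : g.IsFutureCausalCurveOn τ ρ (Icc t₀' (t₀' + 1)) :=
    isFutureCausalCurveOn_of_nullRay hρgeo (fun t ht ↦ (hρnf t ht).2) ha't₀'
  have hjoin : μ S = ρ t₀' := hμS.trans hρq.symm
  obtain ⟨c, hc, hcv⟩ := LorentzianMetric.IsAchronal.exists_pos_smul_velocity_eq hn1 h𝓗 hSpos
    (by linarith : t₀' < t₀' + 1) h₁ h₂ hjoin (by rw [hμx]; exact ha)
    (hρ𝓗 (mem_Ici.2 (by linarith)))
  -- (4) the ray `ρ|[t₀', ∞)` is the maximal geodesic through `(q, ρ' t₀') = (μ S, c μ' S)`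
  have hray := fun (s : ℝ) (hs : 0 ≤ s) ↦
    (hρgeo.mono (Ici_subset_Ici.2 ha't₀')).mem_maximalGeodesicDomain_of_ray (I := 𝓡 4) hs
  have hpt : ∀ (x x' : 𝓢.carrier) (hx : x = x') (v : TangentSpace (𝓡 4) x)
      (v' : TangentSpace (𝓡 4) x'), (v : EuclideanSpace ℝ (Fin 4)) = (v' : EuclideanSpace ℝ (Fin 4)) →
      maximalGeodesicDomain cov x v = maximalGeodesicDomain cov x' v' ∧
        maximalGeodesic cov x v = maximalGeodesic cov x' v' := by
    rintro x x' rfl v v' hv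
    have : v = v' := hv
    subst this
    exact ⟨rfl, rfl⟩
  obtain ⟨hdomeq, hgeoeq⟩ := hpt (ρ t₀') (μ S) hjoin.symm (velocity (𝓡 4) ρ t₀')
    (c • velocity (𝓡 4) μ S) hcv
  -- flow bookkeeping: `γ_{c μ'(S)}(s) = μ(S + c s)`
  have hflow : ∀ s, 0 ≤ s → S + c * s ∈ D ∧ μ (S + c * s) = ρ (t₀' + s) := by
    intro s hs
    obtain ⟨hsdom, hsval⟩ := hray s hs
    rw [hdomeq] at hsdom
    rw [hgeoeq] at hsval
    -- `c s ∈ dom γ_{μ' S}`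
    have hcs : c * s ∈ maximalGeodesicDomain cov (μ S) (velocity (𝓡 4) μ S) := by
      have h1 : c⁻¹ * (c * s) ∈ maximalGeodesicDomain cov (μ S) (c • velocity (𝓡 4) μ S) := by
        rwa [inv_mul_cancel_left₀ hc.ne']
      have h2 := (maximalGeodesic_smul_of_mem (cov := cov) (μ S) (c • velocity (𝓡 4) μ S) c⁻¹ h1).1
      rwa [inv_smul_smul₀ hc.ne'] at h2
    have hdom : c * s + S ∈ D := add_mem_maximalGeodesicDomain_of_translate (cov := cov) (γ a) ℓ hSD hcs
    refine ⟨by rwa [add_comm] at hdom, ?_⟩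
    have htr := (maximalGeodesic_translate (cov := cov) (γ a) ℓ hSD hdom).2
    have hresc := (maximalGeodesic_smul_of_mem (cov := cov) (μ S) (velocity (𝓡 4) μ S) c hcs).2
    have h1 : maximalGeodesic cov (μ S) (velocity (𝓡 4) μ S) (c * s) = μ (c * s + S) :=
      congrArg TotalSpace.proj htr
    rw [add_comm, ← h1, ← hresc, hsval]
  -- (5) assemble
  have hIci : Ici (0 : ℝ) ⊆ D := by
    intro r hr
    rcases le_or_gt r S with hrS | hrS
    · exact h0S ⟨hr, hrS⟩
    · have h := (hflow ((r - S) / c) (div_nonneg (by linarith) hc.le)).1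
      rwa [mul_div_cancel₀ _ hc.ne', add_sub_cancel] at h
  have hmaps : MapsTo μ (Ici 0) 𝓗 := by
    intro r hr
    rcases le_or_gt r S with hrS | hrS
    · exact hμ𝓗₁ r ⟨hr, hrS⟩
    · obtain ⟨-, hval⟩ := hflow ((r - S) / c) (div_nonneg (by linarith) hc.le)
      rw [mul_div_cancel₀ _ hc.ne', add_sub_cancel] at hval
      rw [hval]
      exact hρ𝓗 (mem_Ici.2 (by
        have : 0 ≤ (r - S) / c := div_nonneg (by linarith) hc.le
        linarith))
  exact ⟨ℓ, φ, hℓn, hℓf, hIci, hmaps, fun s hs ↦ hμnf s (hIci hs), hφa, hφc, hφm, hφμ⟩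

/-- **`N(p, S₂) ≥ 1`** (Chruściel–Delay–Galloway–Howard 2001, §6, proof of Thm. 6.1, p. 22: for
`S₁ ⊆ J⁻(S₂)` "if `γ` is a null generator of `𝓗` and `p ∈ γ ∩ S₁` then the point `q ∈ S₂` with
`q ∈ γ` satisfies `φ(q) = p`"; here the existence half). Let `𝓗` be a closed, achronal, embedded
topological hypersurface ruled by future-complete null geodesics, `S₂ ⊆ 𝓗`, and `p ∈ 𝓗` with
`p ∈ J⁻(S₂)`. Then either `p ∈ S₂`, or some complete generator of `𝓗` issuing from `p` (the
maximal geodesic `γ_ℓ`, `ℓ ∈ T_pM` future null, `[0, ∞) ⊆ dom γ_ℓ`, `γ_ℓ([0, ∞)) ⊆ 𝓗`, `γ_ℓ'`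
future null) meets `S₂` at a positive parameter. [cite: ChruscielEtAl2001, §6, proof of Thm. 6.1 (p. 22)] -/
theorem exists_generator_meeting_of_mem_causalPast {𝓗 : Set 𝓢.carrier} (hcl : IsClosed 𝓗)
    (h𝓗 : 𝓢.metric.IsAchronal 𝓢.timeOrientation 𝓗) (htop : IsTopologicalSubmanifold 3 𝓗)
    (hrule : 𝓢.IsRuledByCompleteNullGeodesics 𝓗) {S₂ : Set 𝓢.carrier} (hS₂ : S₂ ⊆ 𝓗)
    {p : 𝓢.carrier} (hp : p ∈ 𝓗) (hJ : p ∈ 𝓢.metric.causalPast 𝓢.timeOrientation S₂) :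
    p ∈ S₂ ∨ ∃ ℓ : TangentSpace (𝓡 4) p,
      𝓢.metric.IsNull ℓ ∧ 𝓢.timeOrientation.IsFutureDirected ℓ ∧
      Ici (0 : ℝ) ⊆ maximalGeodesicDomain 𝓢.metric.leviCivita p ℓ ∧
      MapsTo (maximalGeodesic 𝓢.metric.leviCivita p ℓ) (Ici 0) 𝓗 ∧
      (∀ s ∈ Ici (0 : ℝ),
        𝓢.metric.IsNull (velocity (𝓡 4) (maximalGeodesic 𝓢.metric.leviCivita p ℓ) s) ∧
        𝓢.timeOrientation.IsFutureDirected
          (velocity (𝓡 4) (maximalGeodesic 𝓢.metric.leviCivita p ℓ) s)) ∧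
      ∃ s : ℝ, 0 < s ∧ maximalGeodesic 𝓢.metric.leviCivita p ℓ s ∈ S₂ := by
  rcases hJ with hpS | ⟨q, hq, δ, a, b, hab, hδ, hδa, hδb⟩
  · exact Or.inl hpS
  right
  -- the reversed curve, future causal from `p` to `q`
  set γ : ℝ → 𝓢.carrier := fun t ↦ δ (a + b - t) with hγdef
  have hγ : 𝓢.metric.IsFutureCausalCurveOn 𝓢.timeOrientation γ (Icc a b) :=
    LorentzianMetric.isFutureCausalCurveOn_reverse_reverse_iff.mp hδ.reverseParam
  have hγa : γ a = p := by show δ (a + b - a) = p; rw [add_sub_cancel_left]; exact hδb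
  have hγb : γ b = q := by show δ (a + b - b) = q; rw [add_sub_cancel_right]; exact hδa
  obtain ⟨ℓ, φ, hℓn, hℓf, hIci, hmaps, hnf, hφa, -, hφm, hφμ⟩ :=
    𝓢.exists_generator_of_isFutureCausalCurveOn hcl h𝓗 htop hrule hab hγ
      (by rw [hγa]; exact hp) (by rw [hγb]; exact hS₂ hq)
  -- transport the base point `γ a = p`
  have hpt : ∀ (x x' : 𝓢.carrier) (hx : x = x') (v : TangentSpace (𝓡 4) x)
      (v' : TangentSpace (𝓡 4) x'), (v : EuclideanSpace ℝ (Fin 4)) = (v' : EuclideanSpace ℝ (Fin 4)) →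
      maximalGeodesicDomain 𝓢.metric.leviCivita x v = maximalGeodesicDomain 𝓢.metric.leviCivita x' v' ∧
        maximalGeodesic 𝓢.metric.leviCivita x v = maximalGeodesic 𝓢.metric.leviCivita x' v' := by
    rintro x x' rfl v v' hv
    have : v = v' := hv
    subst this
    exact ⟨rfl, rfl⟩
  obtain ⟨hdomeq, hgeoeq⟩ := hpt (γ a) p hγa ℓ ℓ rfl
  rw [hdomeq] at hIci hφμ
  rw [hgeoeq] at hmaps hnf hφμ
  have hℓn' : 𝓢.metric.IsNull (x := p) ℓ := by rw [← hγa]; exact hℓn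
  have hℓf' : 𝓢.timeOrientation.IsFutureDirected (x := p) ℓ := by rw [← hγa]; exact hℓf
  refine ⟨ℓ, hℓn', hℓf', hIci, hmaps, hnf, φ b, ?_, ?_⟩
  · rw [← hφa]; exact hφm ⟨le_rfl, hab.le⟩ ⟨hab.le, le_rfl⟩ hab
  · rw [← (hφμ b ⟨hab.le, le_rfl⟩).2, hγb]; exact hq

end Spacetime

end Literature.Geometry.Lorentzian
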